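import Mathlib
import Summits.NavierStokesRegularity.NavierStokesRegularity.Theorems.FilamentSkeletonRssClause13ModelBandEstimate

/-!
# Clause 13-J/13-R, brick B7 in `L²` (FAR TRANSPORT BRANCH, FULL 1-D MODEL OPERATOR): the rotation normal form `Z = Y + θ·conj Y`,
# `θ = β₂/(2iG′)`, and the energy estimate `β₀‖Z‖₂² ≤ Re⟨𝓛Y − E, Z⟩`

Route `FilamentSkeletonRss`, ∃-side clause 13 (`Clause13RNearStraightL` stmt-NavierStokesRegularity-23612; typing-agnostic); design of record
`filament-plan/DESIGN-NOTE-28296-tenure-g22.md` §3 (I1) ("the anisotropic part is averaged away by the own-core rotation wherever the rotation rate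
`|G𝔖(μk)| ≫ d` … Normal form: conjugate by `e^K`, `K = O(d/G)`, error `O(d²/G)`") and the remark "after J-averaging the Hermitian part of the
transport-dominated operator is `w′/2 + β̄ = ¾ > 0`, ONE LINE by numerical range".  The landed `…Clause13TransportAveraging(Var)` do this along
characteristics in `L∞`; this file is the `L²` (Eulerian) version for the full 1-D model operator written with its saturated self symbol split off,

  `𝓛Y = iG′·Y − w·Y′ + β₁·Y + β₂·conj Y + Rm`,   `G′ = 2G/q` (own-core rotation rate), `Rm = −iG·K_q∗Y` (the smoothing remainder, small on the
  far branch by `…Clause13SymbolDecay`; here an arbitrary `L²` function),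

with `β₂ = 2iG′·θ` (so `θ = β₂/(2iG′)`, `|θ| ≤ ε = b₂q/(4G) ≪ 1`):

* §1 `farBranch_normalForm_identity` — the POINTWISE identity `𝓛Y − (iG′Z − wZ′ + β₁Z) = E` for `Z = Y + θ·conj Y`,
  `Z′ = Y′ + θ′·conj Y + θ·conj Y′`, with `E = Rm + θ·conj Rm − θ·conj 𝓛Y + (wθ′ + θ·conj β₁ − β₁θ)·conj Y + θ·conj β₂·Y` — the `conj`-linear
  (anisotropic-strain) term is gone: the factor `½` in `θ` is the `2G′` relative rotation of the two helicities;
* §2 `re_inner_rotationTransport_eq` — `Re ∫ (iG′Z − wZ′ + β₁Z)·conj Z = ∫ (½w′ + Re β₁)·‖Z‖²` (the weighted virial p672193 with `W = w`);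
* §3 `model_farBranch_energy` — **if `½w′ + Re β₁ ≥ β₀` (the class gives `≡ ¾` by the trace identity p673488) then
  `β₀·∫‖Z‖² ≤ Re ∫ (𝓛Y − E)·conj Z`**, with the pointwise bounds `(1−ε)‖Y‖ ≤ ‖Z‖ ≤ (1+ε)‖Y‖` and
  `‖E‖ ≤ (1+ε)‖Rm‖ + ε‖𝓛Y‖ + (Λℓ|τ−c| + 2εb₁)‖Y‖ + 2G′ε²‖Y‖` (`|θ′| ≤ ℓ`), so that every error is `O(b²/G′)` or carries the small remainder —
  the note's "error `O(d²/G)`".  Cauchy–Schwarz on the right-hand side (`norm_integral_mul_conj_le`, p696039) turns §3 into the far-branch `L²`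
  lower bound `β₀(1−ε)²‖Y‖₂ ≲ (1+ε)(‖𝓛Y‖₂ + ‖Rm‖₂) + …`; that bookkeeping is left to the gluing step.
Lane ns-filament-19175-p1 g16; `--supports stmt-NavierStokesRegularity-23612 --as helper`.
HONEST FRAMING: identities/inequalities about an explicit 1-D model operator attached to a HYPOTHETICAL filament skeleton on the NEGATIVE side of a
MODEL route; nothing here bears on Navier–Stokes regularity or blow-up; 23610/23612/23320 stay OPEN.
-/

noncomputable section

open MeasureTheory Real Complex Filter Set
open scoped ComplexConjugate Topology

namespace Summit.NavierStokesRegularity.NavierStokesRegularity.Theorems.MatchedKernel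
set_option linter.dupNamespace false

/-! ## §1 The pointwise normal-form identity -/

/-- **ROTATION NORMAL FORM (pointwise algebra).**  For complex numbers `Y Y′ θ θ′ β₁ Rm L` and reals `G′ w`, put `β₂ = 2iG′θ`, `Z = Y + θ·conj Y`,
`Z′ = Y′ + θ′·conj Y + θ·conj Y′`.  If `L = iG′Y − wY′ + β₁Y + β₂·conj Y + Rm` then
`L − (iG′Z − wZ′ + β₁Z) = Rm + θ·conj Rm − θ·conj L + (wθ′ + θ·conj β₁ − β₁θ)·conj Y + θ·conj β₂·Y`. [folklore] -/
theorem farBranch_normalForm_identity (G' w : ℝ) (Y Y' θ θ' β₁ Rm L : ℂ)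
    (hL : L = I * G' * Y - w * Y' + β₁ * Y + (2 * I * G' * θ) * conj Y + Rm) :
    L - (I * G' * (Y + θ * conj Y) - w * (Y' + θ' * conj Y + θ * conj Y') + β₁ * (Y + θ * conj Y))
      = Rm + θ * conj Rm - θ * conj L + (w * θ' + θ * conj β₁ - β₁ * θ) * conj Y + θ * conj (2 * I * G' * θ) * Y := by
  have hconjL : conj L = -(I * G') * conj Y - w * conj Y' + conj β₁ * conj Y + conj (2 * I * G' * θ) * Y + conj Rm := by
    rw [hL]
    simp only [map_add, map_sub, map_mul, Complex.conj_ofReal, Complex.conj_I, Complex.conj_conj, map_ofNat]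
    ring
  rw [hconjL, hL]
  simp only [map_mul, Complex.conj_I, Complex.conj_ofReal, map_ofNat]
  ring

/-- Pointwise comparison `‖Z‖ ≤ (1+ε)‖Y‖` and `(1−ε)‖Y‖ ≤ ‖Z‖` for `Z = Y + θ·conj Y`, `‖θ‖ ≤ ε`. [folklore] -/
theorem norm_normalForm_le {Y θ : ℂ} {ε : ℝ} (hθ : ‖θ‖ ≤ ε) :
    ‖Y + θ * conj Y‖ ≤ (1 + ε) * ‖Y‖ ∧ (1 - ε) * ‖Y‖ ≤ ‖Y + θ * conj Y‖ := by
  have h1 : ‖θ * conj Y‖ ≤ ε * ‖Y‖ := by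
    rw [norm_mul, Complex.norm_conj]; exact mul_le_mul_of_nonneg_right hθ (norm_nonneg _)
  constructor
  · calc ‖Y + θ * conj Y‖ ≤ ‖Y‖ + ‖θ * conj Y‖ := norm_add_le _ _
      _ ≤ ‖Y‖ + ε * ‖Y‖ := by gcongr
      _ = (1 + ε) * ‖Y‖ := by ring
  · have h := norm_sub_le_norm_add Y (θ * conj Y)
    have h' : ‖Y‖ - ‖θ * conj Y‖ ≤ ‖Y + θ * conj Y‖ := by
      have := abs_norm_sub_norm_le Y (-(θ * conj Y))
      rw [norm_neg, sub_neg_eq_add] at this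
      linarith [le_abs_self (‖Y‖ - ‖θ * conj Y‖)]
    calc (1 - ε) * ‖Y‖ = ‖Y‖ - ε * ‖Y‖ := by ring
      _ ≤ ‖Y‖ - ‖θ * conj Y‖ := by linarith
      _ ≤ ‖Y + θ * conj Y‖ := h'

/-- Pointwise bound on the normal-form error:
`‖E‖ ≤ (1+ε)‖Rm‖ + ε‖L‖ + (|w|·ℓ + 2εb₁)‖Y‖ + 2|G′|ε²‖Y‖` when `‖θ‖ ≤ ε`, `‖θ′‖ ≤ ℓ`, `‖β₁‖ ≤ b₁`. [folklore] -/
theorem norm_normalForm_error_le {G' w : ℝ} {Y θ θ' β₁ Rm L : ℂ} {ε ℓ b₁ : ℝ} (hθ : ‖θ‖ ≤ ε) (hθ' : ‖θ'‖ ≤ ℓ) (hb₁ : ‖β₁‖ ≤ b₁) :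
    ‖Rm + θ * conj Rm - θ * conj L + (w * θ' + θ * conj β₁ - β₁ * θ) * conj Y + θ * conj (2 * I * G' * θ) * Y‖
      ≤ (1 + ε) * ‖Rm‖ + ε * ‖L‖ + (|w| * ℓ + 2 * ε * b₁) * ‖Y‖ + 2 * |G'| * ε ^ 2 * ‖Y‖ := by
  have hε : 0 ≤ ε := (norm_nonneg _).trans hθ
  have hb0 : 0 ≤ b₁ := (norm_nonneg _).trans hb₁
  have h1 : ‖θ * conj Rm‖ ≤ ε * ‖Rm‖ := by rw [norm_mul, Complex.norm_conj]; gcongr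
  have h2 : ‖θ * conj L‖ ≤ ε * ‖L‖ := by rw [norm_mul, Complex.norm_conj]; gcongr
  have h3 : ‖(w * θ' + θ * conj β₁ - β₁ * θ) * conj Y‖ ≤ (|w| * ℓ + 2 * ε * b₁) * ‖Y‖ := by
    rw [norm_mul, Complex.norm_conj]
    refine mul_le_mul_of_nonneg_right ?_ (norm_nonneg _)
    calc ‖(w : ℂ) * θ' + θ * conj β₁ - β₁ * θ‖ ≤ ‖(w : ℂ) * θ'‖ + ‖θ * conj β₁‖ + ‖β₁ * θ‖ := by
          refine (norm_sub_le _ _).trans ?_; gcongr; exact norm_add_le _ _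
      _ = |w| * ‖θ'‖ + ‖θ‖ * ‖β₁‖ + ‖β₁‖ * ‖θ‖ := by
          rw [norm_mul, norm_mul, norm_mul, Complex.norm_real, Complex.norm_conj, Real.norm_eq_abs]
      _ ≤ |w| * ℓ + ε * b₁ + b₁ * ε := by gcongr
      _ = |w| * ℓ + 2 * ε * b₁ := by ring
  have h4 : ‖θ * conj (2 * I * G' * θ) * Y‖ ≤ 2 * |G'| * ε ^ 2 * ‖Y‖ := by
    rw [norm_mul, norm_mul, Complex.norm_conj, norm_mul, norm_mul, norm_mul, Complex.norm_I, Complex.norm_real, Real.norm_eq_abs,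
      Complex.norm_two]
    have : ‖θ‖ * (2 * 1 * |G'| * ‖θ‖) = 2 * |G'| * ‖θ‖ ^ 2 := by ring
    rw [this]
    gcongr
  calc ‖Rm + θ * conj Rm - θ * conj L + (w * θ' + θ * conj β₁ - β₁ * θ) * conj Y + θ * conj (2 * I * G' * θ) * Y‖
      ≤ ‖Rm‖ + ‖θ * conj Rm‖ + ‖θ * conj L‖ + ‖(w * θ' + θ * conj β₁ - β₁ * θ) * conj Y‖ + ‖θ * conj (2 * I * G' * θ) * Y‖ := by
        have e1 := norm_add_le (Rm + θ * conj Rm - θ * conj L + (w * θ' + θ * conj β₁ - β₁ * θ) * conj Y) (θ * conj (2 * I * G' * θ) * Y)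
        have e2 := norm_add_le (Rm + θ * conj Rm - θ * conj L) ((w * θ' + θ * conj β₁ - β₁ * θ) * conj Y)
        have e3 := norm_sub_le (Rm + θ * conj Rm) (θ * conj L)
        have e4 := norm_add_le Rm (θ * conj Rm)
        linarith
    _ ≤ ‖Rm‖ + ε * ‖Rm‖ + ε * ‖L‖ + (|w| * ℓ + 2 * ε * b₁) * ‖Y‖ + 2 * |G'| * ε ^ 2 * ‖Y‖ := by gcongr
    _ = (1 + ε) * ‖Rm‖ + ε * ‖L‖ + (|w| * ℓ + 2 * ε * b₁) * ‖Y‖ + 2 * |G'| * ε ^ 2 * ‖Y‖ := by ring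

/-! ## §2 The energy identity of the rotation–transport operator -/

/-- **`Re ∫ (iG′Z − wZ′ + β₁Z)·conj Z = ∫ (½w′ + Re β₁)·‖Z‖²`** for `Z ∈ C¹` with `Z, Z′... ` suitably integrable and a differentiable real slip
`w` with `|w′| ≤ Λ`, `w(c) = 0` (the rotation `iG′` is skew, transport contributes `½w′` by the weighted virial, `β₁` its real part). [folklore] -/
theorem re_inner_rotationTransport_eq {Z Z' : ℝ → ℂ} (hZ : ∀ τ, HasDerivAt Z (Z' τ) τ) (hZ'c : Continuous Z') (G' : ℝ) {c : ℝ}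
    (hZ2 : MemLp Z 2) (hwZ2 : MemLp (fun τ : ℝ => ((τ - c : ℝ) : ℂ) * Z τ) 2) (hwZ'2 : MemLp (fun τ : ℝ => ((τ - c : ℝ) : ℂ) * Z' τ) 2)
    {w : ℝ → ℝ} (hw : Differentiable ℝ w) {Λ : ℝ} (hΛ : ∀ t, |deriv w t| ≤ Λ) (hwc : w c = 0)
    {β₁ : ℝ → ℂ} (hβ₁m : AEStronglyMeasurable β₁ volume) {b₁ : ℝ} (hb₁ : ∀ τ, ‖β₁ τ‖ ≤ b₁) :
    Integrable (fun τ : ℝ => (I * G' * Z τ - ((w τ : ℝ) : ℂ) * Z' τ + β₁ τ * Z τ) * conj (Z τ)) ∧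
    (∫ τ : ℝ, (I * G' * Z τ - ((w τ : ℝ) : ℂ) * Z' τ + β₁ τ * Z τ) * conj (Z τ)).re
      = ∫ τ : ℝ, (1 / 2 * deriv w τ + (β₁ τ).re) * ‖Z τ‖ ^ 2 := by
  have hZc : Continuous Z := continuous_iff_continuousAt.2 fun t => (hZ t).continuousAt
  have hwcont : Continuous w := hw.continuous
  have hΛ0 : 0 ≤ Λ := (abs_nonneg _).trans (hΛ c)
  have hslip : ∀ τ, |w τ| ≤ Λ * |τ - c| := abs_slip_le hw hΛ hwc
  -- the three pieces of the pairing
  have hTZ2 : MemLp (fun τ : ℝ => ((w τ : ℝ) : ℂ) * Z' τ) 2 := memLp_slip_mul hZ'c.aestronglyMeasurable hwZ'2 hw hΛ hwc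
  have hP1 : Integrable (fun τ : ℝ => (I * G' * Z τ) * conj (Z τ)) := (hZ2.const_mul _).integrable_mul (memLp_conj hZ2)
  have hP2 : Integrable (fun τ : ℝ => (((w τ : ℝ) : ℂ) * Z' τ) * conj (Z τ)) := hTZ2.integrable_mul (memLp_conj hZ2)
  have hP3 : Integrable (fun τ : ℝ => (β₁ τ * Z τ) * conj (Z τ)) := (memLp_boundedMultiplier_mul hβ₁m hb₁ hZ2).integrable_mul (memLp_conj hZ2)
  have hsum : Integrable (fun τ : ℝ => (I * G' * Z τ - ((w τ : ℝ) : ℂ) * Z' τ + β₁ τ * Z τ) * conj (Z τ)) := by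
    refine ((hP1.sub hP2).add hP3).congr (Eventually.of_forall fun τ => ?_)
    simp only [Pi.add_apply, Pi.sub_apply]
    ring
  refine ⟨hsum, ?_⟩
  -- split the integral
  have hsplit : ∫ τ : ℝ, (I * G' * Z τ - ((w τ : ℝ) : ℂ) * Z' τ + β₁ τ * Z τ) * conj (Z τ)
      = (∫ τ : ℝ, (I * G' * Z τ) * conj (Z τ)) - (∫ τ : ℝ, (((w τ : ℝ) : ℂ) * Z' τ) * conj (Z τ))
        + ∫ τ : ℝ, (β₁ τ * Z τ) * conj (Z τ) := by
    have e : (fun τ : ℝ => (I * G' * Z τ - ((w τ : ℝ) : ℂ) * Z' τ + β₁ τ * Z τ) * conj (Z τ))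
        = fun τ : ℝ => ((I * G' * Z τ) * conj (Z τ) - (((w τ : ℝ) : ℂ) * Z' τ) * conj (Z τ)) + (β₁ τ * Z τ) * conj (Z τ) := by
      ext τ; ring
    have hI : Integrable (fun τ : ℝ => (I * G' * Z τ) * conj (Z τ) - (((w τ : ℝ) : ℂ) * Z' τ) * conj (Z τ)) := hP1.sub hP2
    rw [e, integral_add hI hP3, integral_sub hP1 hP2]
  -- rotation: purely imaginary
  have hrot : (∫ τ : ℝ, (I * G' * Z τ) * conj (Z τ)).re = 0 := by
    have h : ∫ τ : ℝ, (I * G' * Z τ) * conj (Z τ) = I * G' * ∫ τ : ℝ, Z τ * conj (Z τ) := by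
      rw [← integral_const_mul]
      refine integral_congr_ae (Eventually.of_forall fun τ => ?_)
      simp only
      ring
    have hreal : ∫ τ : ℝ, Z τ * conj (Z τ) = ((∫ τ : ℝ, ‖Z τ‖ ^ 2 : ℝ) : ℂ) := by
      rw [← integral_complex_ofReal]
      refine integral_congr_ae (Eventually.of_forall fun τ => ?_)
      simp only
      rw [Complex.mul_conj, Complex.normSq_eq_norm_sq]
    rw [h, hreal]
    simp [Complex.mul_re, Complex.I_re, Complex.I_im]
  -- transport: weighted virial with `W = w`
  have hg : Integrable (fun τ : ℝ => ((w τ : ℝ) : ℂ) * (conj (Z τ) * Z τ)) := by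
    have hm : AEStronglyMeasurable (fun τ : ℝ => ((w τ : ℝ) : ℂ) * (conj (Z τ) * Z τ)) volume :=
      ((Complex.continuous_ofReal.comp hwcont).mul ((Complex.continuous_conj.comp hZc).mul hZc)).aestronglyMeasurable
    refine ((integrable_abs_weight_mul_norm_sq hZ2 hwZ2).const_mul Λ).mono' hm (Eventually.of_forall fun τ => ?_)
    simp only [norm_mul, Complex.norm_conj, Complex.norm_real, Real.norm_eq_abs]
    calc |w τ| * (‖Z τ‖ * ‖Z τ‖) ≤ Λ * |τ - c| * (‖Z τ‖ * ‖Z τ‖) := by gcongr; exact hslip τ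
      _ = Λ * (|τ - c| * ‖Z τ‖ ^ 2) := by ring
  have h0 : Integrable (fun τ : ℝ => ((deriv w τ : ℝ) : ℂ) * (conj (Z τ) * Z τ)) := by
    have hZZ : Integrable (fun τ : ℝ => conj (Z τ) * Z τ) := by
      have := hZ2.integrable_mul (memLp_conj hZ2)
      refine this.congr (Eventually.of_forall fun τ => ?_)
      simp only [Pi.mul_apply]
      ring
    have hm : AEStronglyMeasurable (fun τ : ℝ => ((deriv w τ : ℝ) : ℂ)) volume :=
      (Complex.measurable_ofReal.comp (measurable_deriv w)).aestronglyMeasurable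
    exact hZZ.bdd_mul hm (c := Λ) (Eventually.of_forall fun τ => by rw [Complex.norm_real, Real.norm_eq_abs]; exact hΛ τ)
  have h1 : Integrable (fun τ : ℝ => ((w τ : ℝ) : ℂ) * (conj (Z' τ) * Z τ + conj (Z τ) * Z' τ)) := by
    have hP : Integrable (fun τ : ℝ => ‖((τ - c : ℝ) : ℂ) * Z' τ‖ * ‖Z τ‖) := hwZ'2.norm.integrable_mul hZ2.norm
    have hm : AEStronglyMeasurable (fun τ : ℝ => ((w τ : ℝ) : ℂ) * (conj (Z' τ) * Z τ + conj (Z τ) * Z' τ)) volume :=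
      ((Complex.continuous_ofReal.comp hwcont).mul
        (((Complex.continuous_conj.comp hZ'c).mul hZc).add ((Complex.continuous_conj.comp hZc).mul hZ'c))).aestronglyMeasurable
    refine (hP.const_mul (2 * Λ)).mono' hm (Eventually.of_forall fun τ => ?_)
    rw [norm_mul, Complex.norm_real, Real.norm_eq_abs]
    have hs : ‖conj (Z' τ) * Z τ + conj (Z τ) * Z' τ‖ ≤ 2 * (‖Z' τ‖ * ‖Z τ‖) := by
      calc ‖conj (Z' τ) * Z τ + conj (Z τ) * Z' τ‖ ≤ ‖conj (Z' τ) * Z τ‖ + ‖conj (Z τ) * Z' τ‖ := norm_add_le _ _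
        _ = 2 * (‖Z' τ‖ * ‖Z τ‖) := by rw [norm_mul, norm_mul, Complex.norm_conj, Complex.norm_conj]; ring
    calc |w τ| * ‖conj (Z' τ) * Z τ + conj (Z τ) * Z' τ‖ ≤ Λ * |τ - c| * (2 * (‖Z' τ‖ * ‖Z τ‖)) := by gcongr; exact hslip τ
      _ = 2 * Λ * (‖((τ - c : ℝ) : ℂ) * Z' τ‖ * ‖Z τ‖) := by
          rw [norm_mul, Complex.norm_real, Real.norm_eq_abs]; ring
  have hvir := integral_realWeight_mul_two_re_eq (W := w) (W' := deriv w) hZ (fun τ => (hw τ).hasDerivAt) hg h0 h1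
  have htr : (∫ τ : ℝ, (((w τ : ℝ) : ℂ) * Z' τ) * conj (Z τ)).re = -(1 / 2) * ∫ τ : ℝ, deriv w τ * ‖Z τ‖ ^ 2 := by
    have hreInt := Complex.reCLM.integral_comp_comm hP2
    simp only [Complex.reCLM_apply] at hreInt
    rw [← hreInt]
    have hre_pt : ∀ τ : ℝ, ((((w τ : ℝ) : ℂ) * Z' τ) * conj (Z τ)).re = (1 / 2 : ℝ) * (w τ * (2 * (conj (Z τ) * Z' τ).re)) := by
      intro τ
      have h : (((w τ : ℝ) : ℂ) * Z' τ) * conj (Z τ) = ((w τ : ℝ) : ℂ) * (conj (Z τ) * Z' τ) := by ring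
      rw [h, Complex.re_ofReal_mul]
      ring
    simp_rw [hre_pt]
    rw [integral_const_mul, hvir]
    ring
  -- local term: real part of `β₁|Z|²`
  have hloc : (∫ τ : ℝ, (β₁ τ * Z τ) * conj (Z τ)).re = ∫ τ : ℝ, (β₁ τ).re * ‖Z τ‖ ^ 2 := by
    have hreInt := Complex.reCLM.integral_comp_comm hP3
    simp only [Complex.reCLM_apply] at hreInt
    rw [← hreInt]
    refine integral_congr_ae (Eventually.of_forall fun τ => ?_)
    simp only
    rw [mul_assoc, Complex.mul_conj, Complex.normSq_eq_norm_sq]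
    rw [show (β₁ τ * ((‖Z τ‖ ^ 2 : ℝ) : ℂ)).re = (β₁ τ).re * ‖Z τ‖ ^ 2 by
      rw [mul_comm, Complex.re_ofReal_mul]; ring]
  -- integrability of the two real integrands, then assemble
  have hZZr : Integrable (fun τ : ℝ => ‖Z τ‖ ^ 2) := (memLp_two_iff_integrable_sq_norm hZ2.1).1 hZ2
  have hI1 : Integrable (fun τ : ℝ => deriv w τ * ‖Z τ‖ ^ 2) :=
    hZZr.bdd_mul (measurable_deriv w).aestronglyMeasurable (c := Λ)
      (Eventually.of_forall fun τ => by rw [Real.norm_eq_abs]; exact hΛ τ)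
  have hI2 : Integrable (fun τ : ℝ => (β₁ τ).re * ‖Z τ‖ ^ 2) := by
    refine hZZr.bdd_mul (Complex.continuous_re.comp_aestronglyMeasurable hβ₁m) (c := b₁)
      (Eventually.of_forall fun τ => ?_)
    rw [Real.norm_eq_abs]
    exact (Complex.abs_re_le_norm _).trans (hb₁ τ)
  rw [hsplit, Complex.add_re, Complex.sub_re, hrot, htr, hloc]
  have hcomb : ∫ τ : ℝ, (1 / 2 * deriv w τ + (β₁ τ).re) * ‖Z τ‖ ^ 2
      = (1 / 2) * (∫ τ : ℝ, deriv w τ * ‖Z τ‖ ^ 2) + ∫ τ : ℝ, (β₁ τ).re * ‖Z τ‖ ^ 2 := by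
    rw [← integral_const_mul, ← integral_add (hI1.const_mul _) hI2]
    refine integral_congr_ae (Eventually.of_forall fun τ => ?_)
    simp only
    ring
  rw [hcomb]
  ring

/-! ## §3 The far-branch energy estimate -/

/-- **FAR-BRANCH ENERGY ESTIMATE (full 1-D model, rotation normal form).**  Let `G′ c β₀ : ℝ`; `Y ∈ C¹` with `Y′` continuous and
`Y, (τ−c)Y, (τ−c)Y′ ∈ L²`; `θ ∈ C¹` with `θ′` continuous, `‖θ‖ ≤ ε`, `‖θ′‖ ≤ ℓ`; `w` a differentiable real slip, `w(c) = 0`, `|w′| ≤ Λ`; `β₁`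
measurable, `‖β₁‖ ≤ b₁`, with the J-AVERAGED GROWTH CONDITION `β₀ ≤ ½w′ + Re β₁` everywhere; `Rm` any remainder.  Put `β₂ = 2iG′θ`,
`𝓛Y = iG′Y − wY′ + β₁Y + β₂conj Y + Rm`, `Z = Y + θ conj Y`, `Z′ = Y′ + θ′conj Y + θ conj Y′`.  Then (i) `β₀·∫‖Z‖² ≤ Re ∫ (iG′Z − wZ′ + β₁Z)·conj Z`,
(ii) pointwise `𝓛Y − (iG′Z − wZ′ + β₁Z) = E` with the §1 error `E` (so the right side of (i) is `Re∫(𝓛Y − E)conj Z`), and (iii) pointwise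
`(1−ε)‖Y‖ ≤ ‖Z‖ ≤ (1+ε)‖Y‖`. [folklore; DESIGN-NOTE-28296 §3 (I1) in `L²`] -/
theorem model_farBranch_energy {G' c β₀ : ℝ} {Y Y' θ θ' : ℝ → ℂ} (hY : ∀ τ, HasDerivAt Y (Y' τ) τ) (hY'c : Continuous Y')
    (hθ : ∀ τ, HasDerivAt θ (θ' τ) τ) (hθ'c : Continuous θ') {ε ℓ : ℝ} (hθε : ∀ τ, ‖θ τ‖ ≤ ε) (hθ'ℓ : ∀ τ, ‖θ' τ‖ ≤ ℓ)
    (hY2 : MemLp Y 2) (hwY2 : MemLp (fun τ : ℝ => ((τ - c : ℝ) : ℂ) * Y τ) 2)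
    (hwY'2 : MemLp (fun τ : ℝ => ((τ - c : ℝ) : ℂ) * Y' τ) 2)
    {w : ℝ → ℝ} (hw : Differentiable ℝ w) {Λ : ℝ} (hΛ : ∀ t, |deriv w t| ≤ Λ) (hwc : w c = 0)
    {β₁ : ℝ → ℂ} (hβ₁m : AEStronglyMeasurable β₁ volume) {b₁ : ℝ} (hb₁ : ∀ τ, ‖β₁ τ‖ ≤ b₁)
    (hgrowth : ∀ τ, β₀ ≤ 1 / 2 * deriv w τ + (β₁ τ).re) (Rm : ℝ → ℂ) :
    let Z : ℝ → ℂ := fun τ => Y τ + θ τ * conj (Y τ)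
    let Z' : ℝ → ℂ := fun τ => Y' τ + θ' τ * conj (Y τ) + θ τ * conj (Y' τ)
    let LY : ℝ → ℂ := fun τ => I * G' * Y τ - ((w τ : ℝ) : ℂ) * Y' τ + β₁ τ * Y τ + (2 * I * G' * θ τ) * conj (Y τ) + Rm τ
    β₀ * ∫ τ : ℝ, ‖Z τ‖ ^ 2
      ≤ (∫ τ : ℝ, (I * G' * Z τ - ((w τ : ℝ) : ℂ) * Z' τ + β₁ τ * Z τ) * conj (Z τ)).re ∧
    (∀ τ, LY τ - (I * G' * Z τ - ((w τ : ℝ) : ℂ) * Z' τ + β₁ τ * Z τ)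
        = Rm τ + θ τ * conj (Rm τ) - θ τ * conj (LY τ) + (w τ * θ' τ + θ τ * conj (β₁ τ) - β₁ τ * θ τ) * conj (Y τ)
          + θ τ * conj (2 * I * G' * θ τ) * Y τ) ∧
    (∀ τ, (1 - ε) * ‖Y τ‖ ≤ ‖Z τ‖ ∧ ‖Z τ‖ ≤ (1 + ε) * ‖Y τ‖) := by
  intro Z Z' LY
  have hYc : Continuous Y := continuous_iff_continuousAt.2 fun t => (hY t).continuousAt
  have hθc : Continuous θ := continuous_iff_continuousAt.2 fun t => (hθ t).continuousAt
  have hε : 0 ≤ ε := (norm_nonneg _).trans (hθε c)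
  -- `Z` is `C¹` with derivative `Z'`
  have hZ : ∀ τ, HasDerivAt Z (Z' τ) τ := by
    intro τ
    show HasDerivAt (fun τ => Y τ + θ τ * conj (Y τ)) (Y' τ + θ' τ * conj (Y τ) + θ τ * conj (Y' τ)) τ
    have h1 : HasDerivAt (fun τ => conj (Y τ)) (conj (Y' τ)) τ := (hY τ).star
    have h2 : HasDerivAt (fun τ => θ τ * conj (Y τ)) (θ' τ * conj (Y τ) + θ τ * conj (Y' τ)) τ := (hθ τ).fun_mul h1
    exact ((hY τ).fun_add h2).congr_deriv (by ring)
  have hZ'c : Continuous Z' := (hY'c.add ((hθ'c.mul (Complex.continuous_conj.comp hYc)))).add (hθc.mul (Complex.continuous_conj.comp hY'c))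
  -- `L²` facts for `Z`, `(τ−c)Z`, `(τ−c)Z'`
  have hθm : AEStronglyMeasurable θ volume := hθc.aestronglyMeasurable
  have hθ'm : AEStronglyMeasurable θ' volume := hθ'c.aestronglyMeasurable
  have hZ2 : MemLp Z 2 := hY2.add (memLp_boundedMultiplier_mul hθm hθε (memLp_conj hY2))
  have hwZ2 : MemLp (fun τ : ℝ => ((τ - c : ℝ) : ℂ) * Z τ) 2 := by
    have h1 : MemLp (fun τ : ℝ => θ τ * conj (((τ - c : ℝ) : ℂ) * Y τ)) 2 := memLp_boundedMultiplier_mul hθm hθε (memLp_conj hwY2)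
    refine (hwY2.add h1).ae_eq (Eventually.of_forall fun τ => ?_)
    simp only [Pi.add_apply, Z, map_mul, Complex.conj_ofReal]
    ring
  have hwZ'2 : MemLp (fun τ : ℝ => ((τ - c : ℝ) : ℂ) * Z' τ) 2 := by
    have h1 : MemLp (fun τ : ℝ => θ' τ * conj (((τ - c : ℝ) : ℂ) * Y τ)) 2 := memLp_boundedMultiplier_mul hθ'm hθ'ℓ (memLp_conj hwY2)
    have h2 : MemLp (fun τ : ℝ => θ τ * conj (((τ - c : ℝ) : ℂ) * Y' τ)) 2 := memLp_boundedMultiplier_mul hθm hθε (memLp_conj hwY'2)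
    refine ((hwY'2.add h1).add h2).ae_eq (Eventually.of_forall fun τ => ?_)
    simp only [Pi.add_apply, Z', map_mul, Complex.conj_ofReal]
    ring
  obtain ⟨_, hre⟩ := re_inner_rotationTransport_eq hZ hZ'c G' hZ2 hwZ2 hwZ'2 hw hΛ hwc hβ₁m hb₁
  refine ⟨?_, fun τ => ?_, fun τ => ?_⟩
  · rw [hre, ← integral_const_mul]
    have hZZr : Integrable (fun τ : ℝ => ‖Z τ‖ ^ 2) := (memLp_two_iff_integrable_sq_norm hZ2.1).1 hZ2
    have hI : Integrable (fun τ : ℝ => (1 / 2 * deriv w τ + (β₁ τ).re) * ‖Z τ‖ ^ 2) := by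
      have hm : AEStronglyMeasurable (fun τ : ℝ => 1 / 2 * deriv w τ + (β₁ τ).re) volume :=
        (((measurable_deriv w).const_mul _).aestronglyMeasurable).add (Complex.continuous_re.comp_aestronglyMeasurable hβ₁m)
      refine hZZr.bdd_mul hm (c := 1 / 2 * Λ + b₁) (Eventually.of_forall fun τ => ?_)
      rw [Real.norm_eq_abs]
      calc |1 / 2 * deriv w τ + (β₁ τ).re| ≤ |1 / 2 * deriv w τ| + |(β₁ τ).re| := abs_add_le _ _
        _ ≤ 1 / 2 * Λ + b₁ := by
            rw [abs_mul, abs_of_pos (by norm_num : (0:ℝ) < 1 / 2)]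
            gcongr
            · exact hΛ τ
            · exact (Complex.abs_re_le_norm _).trans (hb₁ τ)
    exact integral_mono (hZZr.const_mul β₀) hI fun τ => mul_le_mul_of_nonneg_right (hgrowth τ) (by positivity)
  · exact farBranch_normalForm_identity G' (w τ) (Y τ) (Y' τ) (θ τ) (θ' τ) (β₁ τ) (Rm τ) (LY τ) rfl
  · exact ⟨(norm_normalForm_le (hθε τ)).2, (norm_normalForm_le (hθε τ)).1⟩

end Summit.NavierStokesRegularity.NavierStokesRegularity.Theorems.MatchedKernel

end
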